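import Summits.ValiantsHypothesis.ValiantsHypothesis.Theorems.GrenetZeonDualUnipotentThreeHalvesLongMassRankOneAcyclic

/-!
# `GrenetZeon.DualUnipotentThreeHalves` (stmt-ValiantsHypothesis-24318), line `slow_core`, stub `stub_longMassSlowLawInv` ((c)):
# HEREDITARILY NILPOTENT MATRICES OVER A DOMAIN ARE ACYCLIC (ring-generic form of ✓ `…LongMassRankOneAcyclic`)

The combinatorial core ✓ `exists_levels_of_hereditarilyNilpotent` (entries in `ℂ`) restated over an arbitrary commutative DOMAIN `R` (needed for
the RESOLVENT Gram matrix `𝒢(s) = Wᵀ (1 − sA₀)⁻¹ U ∈ M(ℂ[s])` of an affine pencil with rank-one linear part and ARBITRARY nilpotent constant part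
`A₀`, sequel file): if every principal submatrix `G.submatrix c c` (`c` injective) of `G : Matrix ι ι R` is nilpotent, then the support digraph of
`G` is acyclic; stated in LEVEL-VANISHING form ★ `exists_levels_vanishing_of_hereditarilyNilpotent`: `∃ ℓ, ∀ e e', ℓ e' ≤ ℓ e → G e e' = 0`.
Proof as in the `ℂ` file (minimal closed walk is chordless ⇒ weighted cyclic shift ⇒ determinant `± Π h ≠ 0` in a domain ⇒ not nilpotent;
levels = number of `→⁺`-predecessors).  Honest framing: support lemma (`--supports stmt-ValiantsHypothesis-24318`); (c), S3, 24318, 8062,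
VP ≠ VNP OPEN / NOT proved.  No sorry, no definitions, no named facts. [folklore]
-/

-- single-conjunct layout: Sub = Summit, duplicated namespace component intended (the name is mandated)
set_option linter.dupNamespace false
set_option autoImplicit false

noncomputable section

namespace Summit.ValiantsHypothesis.ValiantsHypothesis.Theorems.GrenetZeon.LongMassRankOne

open Matrix
open scoped BigOperators

variable {ι : Type*} {R : Type*} [CommRing R]

/-! ## §1 Re-rooting a closed walk at a chord -/

/-- **RE-ROOTING.**  A closed walk `w : Fin (n+1) → ι` (edges `w a → w (a+1)`, all of non-zero weight) with a CHORD `G (w a) (w b) ≠ 0`,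
`b ≠ a + 1`, contains the strictly shorter closed walk `b, b+1, …, a, b` of length `(a − b) + 1 ≤ n`. -/
theorem exists_shorter_closedWalkR (G : Matrix ι ι R) {n : ℕ} (w : Fin (n + 1) → ι) (hw : ∀ a, G (w a) (w (a + 1)) ≠ 0)
    (a b : Fin (n + 1)) (hab : G (w a) (w b) ≠ 0) (hb : b ≠ a + 1) :
    ∃ d : ℕ, d < n ∧ ∃ w' : Fin (d + 1) → ι, ∀ i, G (w' i) (w' (i + 1)) ≠ 0 := by
  set δ : Fin (n + 1) := a - b with hδ
  have hbδ : b + δ = a := by rw [hδ]; exact add_sub_cancel b a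
  have hδn : (δ : ℕ) < n := by
    rcases (Nat.lt_or_ge (δ : ℕ) n) with h | h
    · exact h
    · exfalso
      have hδlast : δ = Fin.last n := Fin.ext (by rw [Fin.val_last]; have := δ.is_lt; omega)
      apply hb
      rw [← hbδ, hδlast, add_assoc, Fin.last_add_one, add_zero]
  have hle : (δ : ℕ) + 1 ≤ n + 1 := by omega
  refine ⟨δ, hδn, fun i => w (b + Fin.castLE hle i), fun i => ?_⟩
  dsimp only
  by_cases hi : i = Fin.last δ
  · -- the closing chord `a → b`
    have hlast : (Fin.castLE hle (Fin.last (δ : ℕ)) : Fin (n + 1)) = δ := Fin.ext (by rw [Fin.val_castLE, Fin.val_last])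
    rw [hi, Fin.last_add_one, hlast, hbδ]
    simpa using hab
  · -- an edge of the old walk
    rw [castLE_add_one hle i hi, ← add_assoc]
    exact hw _

/-! ## §2 Hereditarily nilpotent matrices have no closed walk -/

/-- A closed walk WITHOUT CHORDS (`G (w a) (w b) ≠ 0 → b = a + 1`) is injective. -/
theorem injective_of_noChordR (G : Matrix ι ι R) {n : ℕ} (w : Fin (n + 1) → ι) (hw : ∀ a, G (w a) (w (a + 1)) ≠ 0)
    (hnc : ∀ a b, G (w a) (w b) ≠ 0 → b = a + 1) : Function.Injective w := by
  intro a b hab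
  have h := hw a
  rw [hab] at h
  have := hnc b (a + 1) h
  exact add_right_cancel this

/-- The principal submatrix of a chordless closed walk is the weighted cyclic shift `diagonal h · P_{+1}`. -/
theorem submatrix_eq_of_noChordR (G : Matrix ι ι R) {n : ℕ} (w : Fin (n + 1) → ι)
    (hnc : ∀ a b, G (w a) (w b) ≠ 0 → b = a + 1) :
    G.submatrix w w = Matrix.diagonal (fun a => G (w a) (w (a + 1))) *
      (1 : Matrix (Fin (n + 1)) (Fin (n + 1)) R).submatrix (finRotate (n + 1)) id := by
  ext a b
  rw [Matrix.submatrix_apply, Matrix.diagonal_mul, Matrix.submatrix_apply, id, finRotate_apply, Matrix.one_apply]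
  by_cases h : a + 1 = b
  · rw [if_pos h, mul_one, h]
  · rw [if_neg h, mul_zero]
    by_contra hne
    exact h (hnc a b hne).symm

/-- The weighted cyclic shift with non-zero weights has non-zero determinant. -/
theorem det_submatrix_ne_zero_of_noChordR [IsDomain R] (G : Matrix ι ι R) {n : ℕ} (w : Fin (n + 1) → ι) (hw : ∀ a, G (w a) (w (a + 1)) ≠ 0)
    (hnc : ∀ a b, G (w a) (w b) ≠ 0 → b = a + 1) : (G.submatrix w w).det ≠ 0 := by
  rw [submatrix_eq_of_noChordR G w hnc, Matrix.det_mul, Matrix.det_diagonal, Matrix.det_permute, Matrix.det_one, mul_one]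
  refine mul_ne_zero (Finset.prod_ne_zero_iff.mpr fun a _ => hw a) ?_
  rcases Int.units_eq_one_or (Equiv.Perm.sign (finRotate (n + 1))) with h | h
  · rw [h, Units.val_one, Int.cast_one]; exact one_ne_zero
  · rw [h, Units.val_neg, Units.val_one, Int.cast_neg, Int.cast_one]; exact neg_ne_zero.mpr one_ne_zero

/-- ★ **A HEREDITARILY NILPOTENT MATRIX HAS NO CLOSED WALK** (of non-zero weights). -/
theorem not_closedWalk_of_hereditarilyNilpotentR [IsDomain R] (G : Matrix ι ι R)
    (hG : ∀ (k : ℕ) (c : Fin k → ι), Function.Injective c → IsNilpotent (G.submatrix c c)) :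
    ∀ (n : ℕ) (w : Fin (n + 1) → ι), ¬ ∀ a, G (w a) (w (a + 1)) ≠ 0 := by
  -- minimal counterexample
  by_contra hex
  push Not at hex
  have hP : ∃ n : ℕ, ∃ w : Fin (n + 1) → ι, ∀ a, G (w a) (w (a + 1)) ≠ 0 := hex
  classical
  set n := Nat.find hP with hn
  obtain ⟨w, hw⟩ : ∃ w : Fin (n + 1) → ι, ∀ a, G (w a) (w (a + 1)) ≠ 0 := Nat.find_spec hP
  -- no chords, by minimality and re-rooting
  have hnc : ∀ a b, G (w a) (w b) ≠ 0 → b = a + 1 := by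
    intro a b hab
    by_contra hb
    obtain ⟨d, hd, w', hw'⟩ := exists_shorter_closedWalkR G w hw a b hab hb
    exact Nat.find_min hP (by rw [← hn]; exact hd) ⟨w', hw'⟩
  -- the principal submatrix is nilpotent with non-zero determinant
  obtain ⟨N, hN⟩ := hG (n + 1) w (injective_of_noChordR G w hw hnc)
  have hdet := congrArg Matrix.det hN
  rw [Matrix.det_pow, Matrix.det_zero] at hdet
  exact det_submatrix_ne_zero_of_noChordR G w hw hnc (pow_eq_zero_iff'.mp hdet).1

/-! ## §3 Walks of the transitive closure; the level function -/

/-- An element of the transitive closure of `e → e' :⇔ G e e' ≠ 0` is witnessed by an open walk. -/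
theorem exists_walk_of_transGenR (G : Matrix ι ι R) {e e' : ι} (h : Relation.TransGen (fun x y => G x y ≠ 0) e e') :
    ∃ (n : ℕ) (w : Fin (n + 2) → ι), w 0 = e ∧ w (Fin.last (n + 1)) = e' ∧ ∀ i : Fin (n + 1), G (w i.castSucc) (w i.succ) ≠ 0 := by
  induction h with
  | single hxy =>
    refine ⟨0, ![e, _], rfl, rfl, fun i => ?_⟩
    have hi : i = 0 := Fin.eq_zero i
    subst hi
    exact hxy
  | @tail y z _ hyz ih =>
    obtain ⟨n, w, h0, hlast, hw⟩ := ih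
    refine ⟨n + 1, Fin.snoc w z, ?_, ?_, fun i => ?_⟩
    · rw [show (0 : Fin (n + 1 + 2)) = (0 : Fin (n + 2)).castSucc from rfl, Fin.snoc_castSucc, h0]
    · rw [show Fin.last (n + 1 + 1) = Fin.last (n + 2) from rfl, Fin.snoc_last]
    · by_cases hi : i = Fin.last (n + 1)
      · subst hi
        rw [Fin.succ_last, Fin.snoc_last, Fin.snoc_castSucc, hlast]
        exact hyz
      · -- an old edge
        set j : Fin (n + 1) := i.castPred hi with hj
        have hij : i = j.castSucc := by rw [hj, Fin.castSucc_castPred]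
        rw [hij, Fin.snoc_castSucc, Fin.succ_castSucc, Fin.snoc_castSucc]
        exact hw j

/-- ★ **The transitive closure of `→` is IRREFLEXIVE for a hereditarily nilpotent matrix** (an open walk from `e` to `e` closes up). -/
theorem transGen_irrefl_of_hereditarilyNilpotentR [IsDomain R] (G : Matrix ι ι R)
    (hG : ∀ (k : ℕ) (c : Fin k → ι), Function.Injective c → IsNilpotent (G.submatrix c c)) (e : ι) :
    ¬ Relation.TransGen (fun x y => G x y ≠ 0) e e := by
  intro h
  obtain ⟨n, w, h0, hlast, hw⟩ := exists_walk_of_transGenR G h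
  refine not_closedWalk_of_hereditarilyNilpotentR G hG n (fun i => w i.castSucc) fun a => ?_
  by_cases ha : a = Fin.last n
  · subst ha
    rw [Fin.last_add_one, Fin.castSucc_zero, h0, ← hlast, ← Fin.succ_last]
    exact hw _
  · have h1 : (a + 1 : Fin (n + 1)).castSucc = a.succ := by
      apply Fin.ext
      rw [Fin.val_castSucc, Fin.val_succ, Fin.val_add_one, if_neg ha]
    rw [h1]
    exact hw a

/-- ★ **HEREDITARILY NILPOTENT ⇒ ACYCLIC, level-vanishing form (any domain).**  If every principal submatrix of `G` is nilpotent, there is a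
level function `ℓ` with `G e e' = 0` whenever `ℓ e' ≤ ℓ e` (all non-zero entries go strictly UP in level). [folklore] -/
theorem exists_levels_vanishing_of_hereditarilyNilpotent [Fintype ι] [IsDomain R] (G : Matrix ι ι R)
    (hG : ∀ (k : ℕ) (c : Fin k → ι), Function.Injective c → IsNilpotent (G.submatrix c c)) :
    ∃ ℓ : ι → ℕ, ∀ e e', ℓ e' ≤ ℓ e → G e e' = 0 := by
  classical
  refine ⟨fun e => (Finset.univ.filter fun x => Relation.TransGen (fun x y => G x y ≠ 0) x e).card, fun e e' hle => ?_⟩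
  by_contra hee'
  apply absurd hle
  apply not_le.mpr
  apply Finset.card_lt_card
  rw [Finset.ssubset_iff_of_subset]
  · refine ⟨e, ?_, ?_⟩
    · rw [Finset.mem_filter]; exact ⟨Finset.mem_univ _, Relation.TransGen.single hee'⟩
    · rw [Finset.mem_filter, not_and]; exact fun _ => transGen_irrefl_of_hereditarilyNilpotentR G hG e
  · intro x hx
    rw [Finset.mem_filter] at hx ⊢
    exact ⟨hx.1, hx.2.tail hee'⟩

end Summit.ValiantsHypothesis.ValiantsHypothesis.Theorems.GrenetZeon.LongMassRankOne

end
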